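import Summits.AnomalousDissipation.AnomalousDissipation.Theorems.SolenoidalFractalHomogenisationLagrangianStepOneLevelSplitGlueL
import Summits.AnomalousDissipation.AnomalousDissipation.Theorems.SolenoidalFractalHomogenisationLagrangianStepOneLevelSplitDefsH
import HarnessLib

/-!
# K1L_D (stmt-AnomalousDissipation-27980), registry v4 (tenure D24-23 / D25-1): the TWO GLUES of the high-label re-cut — prover-owned «GlueH»
# (`--kind proof --supports stmt-AnomalousDissipation-27980 --as helper`; text = planner ad-ideate-p1 g25, to be landed byte-for-byte)

1. `chainLower_of_oneLevel_at` — the landed chain glue `chainLower_of_pieces_ISW` (…OneLevelGlueLowerFamilyGlue) made POINTWISE in the design data: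
   instead of the universally quantified one-level binder `hone : ∀ k W M hM c Φ …, (V) → (F) → ∃ ν₁ …` it takes the one-level comparison AT the
   given `(k, W, M, c, Φ, window)` — `hlev : ∃ ν₁ K₁ Λ₀ θ₀ C₁ σ₁, ∀ E …` (the CONCLUSION of the registered `stub_oneLevelL_IW` text) — and returns the
   regime pins with `ChainLower E`.  Proof = the landed one from its `refine ⟨ν₁, …⟩` onward, verbatim.  WHY: in registry v4 the one-level comparison
   carries the high-label decay family (H) as an extra hypothesis, and (H) is available only for the DESIGN word (W7 `stub_highLabelDecay_IS` is
   design-specific — (H) at every word is false), so the composition must glue at the point `W = cubatureWord`.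
2. `oneLevelL_IWH_of_piecesH` — **S0′ → S23‴ → IW_H**: the v3 glue `oneLevelL_IW_of_piecesL` (…OneLevelSplitGlueL, p653751) RE-CUT for the v4 window
   stub S23‴ (`stub_windowDefectH`, text of record = p4 g12 `windowDefectH_textKb` 67be95a17dc9ee1d, tenure D25-1): S23‴ takes the high-label decay
   FAMILY `(∀ Kb ≥ 1, ∃ CK ≥ 1, ∃ cK > 0, ∃ νh > 0, HighLabelDecayW W M hM lo hi Λ β νh Kb CK cK)` as a hypothesis and concludes the TRIMMED energy
   comparison `‖U¹_{0→t} x₁‖² ≤ ‖U⁰_{0→t} x₁‖² + Cη ρ^ση (‖x₁‖² − ‖U⁰_{0→t} x₁‖²)` directly (the window ledger now runs INSIDE S23‴), so this glue is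
   GlueL with the ledger block removed: both propagators from S0′, the datum trimmed to `w₁ := P_{Lc} w₀`, the tail `x₂ := x − x₁ ⊥ x₁` restored by
   `trim_compare` with the budget `4π²‖x₂‖² ≤ Cτ ρ^στ · D` from the S23‴ export, the spectral gap and `stub_baseT`.  The conclusion IW_H is the registered
   `stub_oneLevelL_IW` text with the SAME (H)-hypothesis line inserted after its (F) line — (H) rides through; constants `C₁ := 2Cη + 18Cτ/(4π²) + 3`,
   `σ₁ := min ση (στ/2)`.
NOT a proof of S23‴, W7 or AD; rung F-D1.A0 unchanged.
-/

set_option linter.dupNamespace false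

noncomputable section

namespace Summit.AnomalousDissipation.AnomalousDissipation.Theorems.SolenoidalFractalHomogenisation.LagrangianStep

open Literature.Analysis Literature.Analysis.FluidPDE Literature.Analysis.FunctionSpaces
open MeasureTheory Set Filter ContinuousLinearMap
open scoped ENNReal NNReal InnerProductSpace
open Summit.AnomalousDissipation.AnomalousDissipation.Theorems.SolenoidalFractalHomogenisation.RealisedQuasiStaticCellLaw
open Summit.AnomalousDissipation.AnomalousDissipation.Theorems.SolenoidalFractalHomogenisation.LagrangianRenormalisationStep
open OneLevelSplit

set_option maxHeartbeats 400000 in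
/-- **Pointwise chain glue (v4).**  `chainLower_of_pieces_ISW` with the one-level comparison supplied AT the given design data (the conclusion of the
registered one-level text at `(k, W, M, c, Φ, lo, hi, β)`) instead of as a universally quantified binder; window facts along the chain from the
sectorial interval window family exactly as landed. -/
theorem chainLower_of_oneLevel_at
    (hba : ∀ k (E : LatticeShear.LagrangianLatticeCarrier k), E.LPermissible → E.Regular →
    ∀ (m : ℕ) (𝔸 : Torus.Visc4 (Fin 3)) (lo hi : ℝ), 0 < lo → Torus.NearIso 𝔸 lo hi →
      ∀ (w₀ : VF) (u : ℝ → VF), IsDatum w₀ → TSol E m 𝔸 w₀ u →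
        ∀ᵐ t ∂(volume.restrict (Ioo (1/2 : ℝ) 1)),
          (1 - Real.exp (-(4 * Real.pi ^ 2 * lo))) * Torus.vectorL2Sq w₀ ≤ drop w₀ u t)
    {k : ℕ} {W : Literature.Analysis.FluidPDE.LatticeShear.LatticeWord k} {M : ℝ} {hM : 0 < M} {c : ℝ}
    {Φ : ℝ → Torus.Visc4 (Fin 3) → Torus.Visc4 (Fin 3)} {μ : ℝ → ℝ} {Sstar : Torus.Visc4 (Fin 3)}
    {slo shi lam₀ Λ Λc Λ' τlo τhi τc lo hi ΛV β : ℝ}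
    (hlo : 0 < lo) (hhi1 : 1 ≤ hi) (hWF : SectorialIntervalWindowFamily Φ μ Sstar slo shi lam₀ Λ Λc Λ' τlo τhi τc β lo hi ΛV)
    (hlev : ∃ ν₁ > (0:ℝ), ∃ K₁ > (0:ℝ), ∃ Λ₀ : ℕ, ∃ θ₀ > (0:ℝ), ∃ C₁ > (0:ℝ), ∃ σ₁ > (0:ℝ),
        ∀ E : Literature.Analysis.FluidPDE.LatticeShear.LagrangianLatticeCarrier k, E.design = W.stretch M hM → E.gain = c → E.nu0 = ν₁ → E.K = K₁ → E.LPermissible → E.Regular → (∀ m, Λ₀ * E.N m ≤ E.N (m + 1)) → (∀ m, E.N m ^ 2 ≤ E.N (m + 1)) → (∀ m, E.cellVisc (m + 1) * ((E.N (m + 1) : ℝ) / E.N m) ^ (1 / 4 : ℝ) ≤ 1) → (∀ m, E.K * ((E.N (m + 1) : ℝ) / E.N m) ^ (1 / 4 : ℝ) ≤ ((E.N (m + 1) : ℝ) / E.N m) * E.cellVisc (m + 1)) → (∀ m, E.θ (m + 1) * ((E.N (m + 1) : ℝ) / E.N m) ^ (1 / 16 : ℝ) ≤ θ₀) → (∀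 m, ((E.N (m + 1) : ℝ) / E.N m) ^ (1 / 16 : ℝ) * E.physPeriod (m + 1) ≤ E.refresh (m + 1)) →
        ∀ R : ℝ≥0, ∃ mstar : ℕ, ∀ m, mstar ≤ m →
          ∀ S : Torus.Visc4 (Fin 3), Torus.OddSmall S β → Torus.NearIso S lo hi →
            Torus.OddSmall (Φ (E.cellVisc (m + 1)) S) β → Torus.NearIso (Φ (E.cellVisc (m + 1)) S) lo hi →
          ∀ (w₀ : VF), IsDatum w₀ → InClass R w₀ →
          ∀ u v : ℝ → VF, TSol E (m + 1) (E.kbar (m + 1) • S) w₀ u →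
            TSol E m (E.kbar m • renormStep (Φ (E.cellVisc (m + 1))) (E.gain / E.cellVisc (m + 1) ^ 2) S) w₀ v →
            ∀ᵐ t ∂(volume.restrict (Ioo (1/2 : ℝ) 1)),
              (1 - C₁ * ((E.N m : ℝ) / E.N (m + 1)) ^ σ₁) * drop w₀ v t ≤ drop w₀ u t) :
    ∃ ν₁ > (0:ℝ), ∃ K₁ > (0:ℝ), ∃ Λ₀ : ℕ, ∃ θ₀ > (0:ℝ),
        ∀ E : Literature.Analysis.FluidPDE.LatticeShear.LagrangianLatticeCarrier k, E.design = W.stretch M hM → E.gain = c → E.nu0 = ν₁ → E.K = K₁ → E.LPermissible → E.Regular → (∀ m, Λ₀ * E.N m ≤ E.N (m + 1)) → (∀ m, E.N m ^ 2 ≤ E.N (m + 1)) → (∀ m, E.cellVisc (m + 1) * ((E.N (m + 1) : ℝ) / E.N m) ^ (1 / 4 : ℝ) ≤ 1) → (∀ m, E.K * ((E.N (m + 1) : ℝ) / E.N m) ^ (1 / 4 : ℝ) ≤ ((E.N (m + 1) : ℝ) / E.N m) * E.cellVisc (m + 1)) → (∀ m, E.θ (m + 1) * ((E.N (m + 1)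 : ℝ) / E.N m) ^ (1 / 16 : ℝ) ≤ θ₀) → (∀ m, ((E.N (m + 1) : ℝ) / E.N m) ^ (1 / 16 : ℝ) * E.physPeriod (m + 1) ≤ E.refresh (m + 1)) → ChainLower E := by
  obtain ⟨ν₁, hν₁, K₁, hK₁, Λ₀, θ₀, hθ₀, C₁, hC₁, σ₁, hσ₁, hlev⟩ := hlev
  refine ⟨ν₁, hν₁, K₁, hK₁, Λ₀, θ₀, hθ₀, ?_⟩
  intro E hW hg hn hK' hP hR h1a h1b h2 h3 h4 h5
  have hlevE := hlev E hW hg hn hK' hP hR h1a h1b h2 h3 h4 h5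
  obtain ⟨hwin, hμ, htailB, hslo, hlamc, hΛcΛ, hloc, hhic, _, _, _, hτc, hτc0, hτcβ, _⟩ := hWF
  obtain ⟨m₁, htail⟩ := htailB k E hP h1b h2
  have hhi0 : 0 ≤ hi := zero_le_one.trans hhi1
  have hτhi : 0 ≤ τc * hi := mul_nonneg hτc0 hhi0
  have hwinT : ∀ j m, m₁ ≤ m → m ≤ j → Torus.NearIso (chainTensorF E Φ j m) (E.kbar m * lo) (E.kbar m * hi) :=
    fun j m hm hmj => (chainTensorF_nearIsoS E hslo.le hτc hτc0 hwin hμ hΛcΛ hlo.le hloc hhic htail hm hmj).2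
  refine ⟨lo, hlo, hi, C₁, hC₁, σ₁, hσ₁, ?_⟩
  intro R
  obtain ⟨mstar, hm⟩ := hlevE R
  refine ⟨max mstar m₁, fun j hj => ⟨chainTensorF E Φ j, chainTensorF_top E Φ j,
    fun m hm1 hm2 => hwinT j m ((le_max_right _ _).trans hm1) hm2, ?_⟩⟩
  intro m hm1 hm2 w₀ hdat hcl
  have hm1' : m₁ ≤ m := (le_max_right _ _).trans hm1
  have hm1'' : mstar ≤ m := (le_max_left _ _).trans hm1
  obtain ⟨⟨hSo, hSn⟩, _⟩ := chainTensorF_nearIsoS E hslo.le hτc hτc0 hwin hμ hΛcΛ hlo.le hloc hhic htail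
    (show m₁ ≤ m + 1 by omega) (show m + 1 ≤ j by omega)
  obtain ⟨hΦo, hΦn⟩ := chainImage_nearIsoS E hslo.le hτc hτc0 hwin hμ hΛcΛ hlo.le hloc hhic htail hm1' hm2
  have hstep := hm m hm1'' _ (hSo.mono hτhi hτcβ) hSn (hΦo.mono hτhi hτcβ) hΦn w₀ hdat hcl
  refine ⟨existsL_tensor E hR m (hwinT j m hm1' hm2.le) (mul_pos (E.kbar_pos m) hlo) w₀ hdat, ?_⟩
  intro u v hu hv
  have hv' := hv
  rw [chainTensorF_succ E Φ hm2] at hv'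
  have hu' : TSol E (m + 1) (E.kbar (m + 1) • shapeSeqF (fun i => Φ (E.cellVisc i)) (fun i => E.gain / E.cellVisc i ^ 2) j (j - (m + 1))) w₀ u := hu
  have hcmp := hstep u v hu' hv'
  have hbase := hba k E hP hR m (chainTensorF E Φ j m) (E.kbar m * lo) (E.kbar m * hi)
    (mul_pos (E.kbar_pos m) hlo) (hwinT j m hm1' hm2.le) w₀ v hdat hv
  have hcb : 0 ≤ 1 - Real.exp (-(4 * Real.pi ^ 2 * (E.kbar m * lo))) := by
    have hexp : Real.exp (-(4 * Real.pi ^ 2 * (E.kbar m * lo))) < 1 := by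
      rw [Real.exp_lt_one_iff]
      have : 0 < 4 * Real.pi ^ 2 * (E.kbar m * lo) := by
        have := E.kbar_pos m
        positivity
      linarith
    linarith
  have hL2 : 0 ≤ Torus.vectorL2Sq w₀ := by
    show 0 ≤ ∫ x, ‖w₀ x‖ ^ 2
    exact integral_nonneg fun x => by positivity
  filter_upwards [hcmp, hbase] with t h1 h2
  exact ⟨le_trans (mul_nonneg hcb hL2) h2, h1⟩

set_option maxHeartbeats 400000 in
/-- **The v4 one-level cut composes: `S0′ → S23‴ → IW_H`.**  Both propagators from S0′; the datum is trimmed to `w₁ := P_{Lc} w₀` (again a class-`R`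
datum, band-limited); S23‴ gives the trimmed comparison `‖U¹x₁‖² ≤ ‖U⁰x₁‖² + Cη ρ^ση D₁` for `x₁ := datumLp w₁`; the trimmed-off tail `x₂ := x − x₁ ⊥ x₁`
is restored by `trim_compare`, its budget `‖x₂‖² ≤ (Cτ/4π²)·ρ^στ·drop_v` coming from the S23‴ export, the spectral gap and `stub_baseT`.  The high-label
decay family (H) is a hypothesis of both S23‴ and the conclusion and is passed through untouched. -/
theorem oneLevelL_IWH_of_piecesH :
    (∀ k (E : LatticeShear.LagrangianLatticeCarrier k), E.LPermissible → E.Regular →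
    ∀ (m : ℕ) (𝔸 : Torus.Visc4 (Fin 3)) (lo hi : ℝ), 0 < lo → Torus.NearIso 𝔸 lo hi →
      ∃ U : ℝ → ℝ → (V2 →L[ℝ] V2), Torus.IsPropagator 1 (E.partialSum m) 𝔸 U) →
    (∀ k (W : Literature.Analysis.FluidPDE.LatticeShear.LatticeWord k) (M : ℝ) (hM : 0 < M) (c : ℝ), 0 < c →
    ∀ (Φ : ℝ → Torus.Visc4 (Fin 3) → Torus.Visc4 (Fin 3)) (lo hi Λ β σ C ν₀ K Cf νf Kf : ℝ),
      0 < lo → lo ≤ 1 → 1 ≤ hi → 1 < Λ → 0 ≤ β →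
      0 < σ → 0 ≤ C → 0 < ν₀ → 0 < K → SlowVectorClauseF W M hM c Φ lo hi Λ β σ C ν₀ K →
      0 ≤ Cf → 0 < νf → 0 < Kf → CellEnergyClausesW W M hM c lo hi Λ β Cf νf Kf →
      (∀ Kb : ℝ, 1 ≤ Kb → ∃ CK : ℝ, 1 ≤ CK ∧ ∃ cK > (0:ℝ), ∃ νh > (0:ℝ), HighLabelDecayW W M hM lo hi Λ β νh Kb CK cK) →
      ∃ ν₁ > (0:ℝ), ∃ K₁ > (0:ℝ), ∃ Λ₀ : ℕ, ∃ θ₀ > (0:ℝ), ∃ Cη > (0:ℝ), ∃ ση > (0:ℝ), ∃ Cτ > (0:ℝ), ∃ στ > (0:ℝ),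
        ∀ E : Literature.Analysis.FluidPDE.LatticeShear.LagrangianLatticeCarrier k, E.design = W.stretch M hM → E.gain = c → E.nu0 ≤ ν₁ → K₁ ≤ E.K →
          E.LPermissible → E.Regular → (∀ m, Λ₀ * E.N m ≤ E.N (m + 1)) → (∀ m, E.N m ^ 2 ≤ E.N (m + 1)) →
          (∀ m, E.cellVisc (m + 1) * ((E.N (m + 1) : ℝ) / E.N m) ^ (1 / 4 : ℝ) ≤ 1) →
          (∀ m, E.K * ((E.N (m + 1) : ℝ) / E.N m) ^ (1 / 4 : ℝ) ≤ ((E.N (m + 1) : ℝ) / E.N m) * E.cellVisc (m + 1)) →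
          (∀ m, E.θ (m + 1) * ((E.N (m + 1) : ℝ) / E.N m) ^ (1 / 16 : ℝ) ≤ θ₀) →
          (∀ m, ((E.N (m + 1) : ℝ) / E.N m) ^ (1 / 16 : ℝ) * E.physPeriod (m + 1) ≤ E.refresh (m + 1)) →
        ∀ R : ℝ≥0, ∃ mstar : ℕ, ∀ m, mstar ≤ m →
          ∃ Lc : ℕ,
          (R : ℝ) ≤ Cτ * ((E.N m : ℝ) / E.N (m + 1)) ^ στ * (Lc : ℝ) ^ 2 * (1 - Real.exp (-(4 * Real.pi ^ 2 * (E.kbar m * lo)))) ∧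
          Cη * ((E.N m : ℝ) / E.N (m + 1)) ^ ση ≤ 1 / 8 ∧
          ∀ S : Torus.Visc4 (Fin 3), Torus.OddSmall S β → Torus.NearIso S lo hi →
            Torus.OddSmall (Φ (E.cellVisc (m + 1)) S) β → Torus.NearIso (Φ (E.cellVisc (m + 1)) S) lo hi →
          ∀ (w₁ : VF) (hw₁ : IsDatum w₁), InClass R w₁ → Torus.fourierTruncate Lc w₁ = w₁ →
          ∀ Um Um1 : ℝ → ℝ → (V2 →L[ℝ] V2),
            Torus.IsPropagator 1 (E.partialSum m) (E.kbar m • renormStep (Φ (E.cellVisc (m + 1))) (E.gain / E.cellVisc (m + 1) ^ 2) S) Um →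
            Torus.IsPropagator 1 (E.partialSum (m + 1)) (E.kbar (m + 1) • S) Um1 →
          ∀ t ∈ Ioo (1/2 : ℝ) 1,
            ‖Um1 0 t (datumLp w₁ hw₁)‖ ^ 2
              ≤ ‖Um 0 t (datumLp w₁ hw₁)‖ ^ 2
                + Cη * ((E.N m : ℝ) / E.N (m + 1)) ^ ση * (‖datumLp w₁ hw₁‖ ^ 2 - ‖Um 0 t (datumLp w₁ hw₁)‖ ^ 2)) →
    ∀ k (W : Literature.Analysis.FluidPDE.LatticeShear.LatticeWord k) (M : ℝ) (hM : 0 < M) (c : ℝ), 0 < c →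
    ∀ (Φ : ℝ → Torus.Visc4 (Fin 3) → Torus.Visc4 (Fin 3)) (lo hi Λ β σ C ν₀ K Cf νf Kf : ℝ),
      0 < lo → lo ≤ 1 → 1 ≤ hi → 1 < Λ → 0 ≤ β →
      0 < σ → 0 ≤ C → 0 < ν₀ → 0 < K → SlowVectorClauseF W M hM c Φ lo hi Λ β σ C ν₀ K →
      0 ≤ Cf → 0 < νf → 0 < Kf → CellEnergyClausesW W M hM c lo hi Λ β Cf νf Kf →
      (∀ Kb : ℝ, 1 ≤ Kb → ∃ CK : ℝ, 1 ≤ CK ∧ ∃ cK > (0:ℝ), ∃ νh > (0:ℝ), HighLabelDecayW W M hM lo hi Λ β νh Kb CK cK) →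
      ∃ ν₁ > (0:ℝ), ∃ K₁ > (0:ℝ), ∃ Λ₀ : ℕ, ∃ θ₀ > (0:ℝ), ∃ C₁ > (0:ℝ), ∃ σ₁ > (0:ℝ),
        ∀ E : Literature.Analysis.FluidPDE.LatticeShear.LagrangianLatticeCarrier k, E.design = W.stretch M hM → E.gain = c → E.nu0 = ν₁ → E.K = K₁ → E.LPermissible → E.Regular → (∀ m, Λ₀ * E.N m ≤ E.N (m + 1)) → (∀ m, E.N m ^ 2 ≤ E.N (m + 1)) → (∀ m, E.cellVisc (m + 1) * ((E.N (m + 1) : ℝ) / E.N m) ^ (1 / 4 : ℝ) ≤ 1) → (∀ m, E.K * ((E.N (m + 1) : ℝ) / E.N m) ^ (1 / 4 : ℝ) ≤ ((E.N (m + 1) : ℝ) / E.N m) * E.cellVisc (m + 1)) → (∀ m, E.θ (m + 1) * ((E.N (m + 1) : ℝ) / E.N m) ^ (1 / 16 : ℝ) ≤ θ₀) → (∀ m, ((E.N (m + 1) : ℝ) / E.N m) ^ (1 / 16 : ℝ) * E.physPeriod (m + 1) ≤ E.refresh (m + 1)) →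
        ∀ R : ℝ≥0, ∃ mstar : ℕ, ∀ m, mstar ≤ m →
          ∀ S : Torus.Visc4 (Fin 3), Torus.OddSmall S β → Torus.NearIso S lo hi →
            Torus.OddSmall (Φ (E.cellVisc (m + 1)) S) β → Torus.NearIso (Φ (E.cellVisc (m + 1)) S) lo hi →
          ∀ (w₀ : VF), IsDatum w₀ → InClass R w₀ →
          ∀ u v : ℝ → VF, TSol E (m + 1) (E.kbar (m + 1) • S) w₀ u →
            TSol E m (E.kbar m • renormStep (Φ (E.cellVisc (m + 1))) (E.gain / E.cellVisc (m + 1) ^ 2) S) w₀ v →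
            ∀ᵐ t ∂(volume.restrict (Ioo (1/2 : ℝ) 1)),
              (1 - C₁ * ((E.N m : ℝ) / E.N (m + 1)) ^ σ₁) * drop w₀ v t ≤ drop w₀ u t := by
  intro hS0 hS23 k W M hM c hc Φ lo hi Λ β σ C ν₀ K Cf νf Kf hlo hlo1 hhi hΛ hβ hσ hC hν₀ hK hV hCf hνf hKf hF hH
  obtain ⟨ν₁, hν₁, K₁, hK₁, Λ₀, θ₀, hθ₀, Cη, hCη, ση, hση, Cτ, hCτ, στ, hστ, hD⟩ :=
    hS23 k W M hM c hc Φ lo hi Λ β σ C ν₀ K Cf νf Kf hlo hlo1 hhi hΛ hβ hσ hC hν₀ hK hV hCf hνf hKf hF hH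
  refine ⟨ν₁, hν₁, K₁, hK₁, Λ₀, θ₀, hθ₀, 2 * Cη + (18 * (Cτ / (4 * Real.pi ^ 2)) + 3), by positivity,
    min ση (στ / 2), lt_min hση (half_pos hστ), ?_⟩
  intro E hdes hgain hnu0 hKE hLP hReg hT2 hN2 hT3a hT3b hT4 hT5 R
  obtain ⟨m₁, hm₁⟩ := hD E hdes hgain hnu0.le hKE.symm.le hLP hReg hT2 hN2 hT3a hT3b hT4 hT5 R
  refine ⟨m₁, fun m hm S hS₁ hS₂ hS₃ hS₄ w₀ hw₀ hR u v hu hv => ?_⟩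
  obtain ⟨Lc, htrim, _hη8, hDm⟩ := hm₁ m hm
  -- the two propagators from S0′
  have hgain0 : 0 ≤ E.gain := hgain ▸ hc.le
  have h𝔸v : Torus.NearIso (E.kbar m • renormStep (Φ (E.cellVisc (m + 1))) (E.gain / E.cellVisc (m + 1) ^ 2) S)
      (E.kbar m * lo) (E.kbar m * hi) :=
    (nearIso_renormStep (div_nonneg hgain0 (sq_nonneg _)) hS₂ hS₄).smul (E.kbar_pos m).le
  have h𝔸u : Torus.NearIso (E.kbar (m + 1) • S) (E.kbar (m + 1) * lo) (E.kbar (m + 1) * hi) :=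
    hS₂.smul (E.kbar_pos (m + 1)).le
  obtain ⟨Um, hUm⟩ := hS0 k E hLP hReg m _ _ _ (mul_pos (E.kbar_pos m) hlo) h𝔸v
  obtain ⟨Um1, hUm1⟩ := hS0 k E hLP hReg (m + 1) _ _ _ (mul_pos (E.kbar_pos (m + 1)) hlo) h𝔸u
  -- the trimmed datum `w₁ := P_{Lc} w₀`: again a class-`R` datum, band-limited
  have hw₀2 : MemLp w₀ 2 volume := memLp_two_of_memSobolev_one_complexify hw₀.1
  have hw₁ : IsDatum (Torus.fourierTruncate Lc w₀) := isDatum_fourierTruncate hw₀ Lc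
  have hR₁ : InClass R (Torus.fourierTruncate Lc w₀) := inClass_fourierTruncate hw₀2 hR Lc
  have hband : Torus.fourierTruncate Lc (Torus.fourierTruncate Lc w₀) = Torus.fourierTruncate Lc w₀ :=
    fourierTruncate_fourierTruncate (hw₀2.integrable one_le_two) Lc
  -- a.e. representation of `u t` and `v t` through the propagators, and the `stub_baseT` floor of `drop_v`
  have hrepu := hUm1.repr 0 le_rfl zero_lt_one w₀ hw₀2 hw₀.2.2 u (by simpa only [TSol, sub_zero, zero_add] using hu)
  have hrepv := hUm.repr 0 le_rfl zero_lt_one w₀ hw₀2 hw₀.2.2 v (by simpa only [TSol, sub_zero, zero_add] using hv)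
  have hbase := stub_baseT k E hLP hReg m _ _ _ (mul_pos (E.kbar_pos m) hlo) h𝔸v w₀ v hw₀ hv
  have hsub : Ioo (1/2 : ℝ) 1 ⊆ Ioo 0 (1 - 0) := by
    rw [sub_zero]; exact Ioo_subset_Ioo (by norm_num) le_rfl
  filter_upwards [ae_restrict_of_ae_restrict_of_subset hsub hrepu, ae_restrict_of_ae_restrict_of_subset hsub hrepv, hbase,
    ae_restrict_mem measurableSet_Ioo] with t hu1 hv1 hbt ht
  obtain ⟨hut, hute⟩ := hu1
  obtain ⟨hvt, hvte⟩ := hv1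
  rw [zero_add] at hute hvte
  -- names: the datum class `x`, its trimmed part `x₁ = cutLp Lc x`, the tail `x₂ := x - x₁`
  set x : V2 := datumLp w₀ hw₀ with hx_def
  set x₁ : V2 := datumLp (Torus.fourierTruncate Lc w₀) hw₁ with hx₁_def
  have hx₁ : x₁ = cutLp Lc x := datumLp_fourierTruncate hw₀ Lc hw₁
  -- energies through the propagators
  have hEu : ∫ a, ‖u t a‖ ^ 2 = ‖Um1 0 t x‖ ^ 2 := by
    rw [← norm_toLp_sq hut, hute]; rfl
  have hEv : ∫ a, ‖v t a‖ ^ 2 = ‖Um 0 t x‖ ^ 2 := by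
    rw [← norm_toLp_sq hvt, hvte]; rfl
  have hE0 : Torus.vectorL2Sq w₀ = ‖x‖ ^ 2 := (norm_datumLp_sq w₀ hw₀).symm
  -- the trimmed comparison (S23‴) for the trimmed datum
  have hcmp₁ := hDm S hS₁ hS₂ hS₃ hS₄ (Torus.fourierTruncate Lc w₀) hw₁ hR₁ hband Um Um1 hUm hUm1 t ht
  set ρ : ℝ := (E.N m : ℝ) / E.N (m + 1) with hρ_def
  have hρ0 : 0 ≤ ρ := rho_nonneg _ _
  have hρ1 : ρ ≤ 1 := rho_le_one (hN2 m)
  have hρpos : 0 < ρ := div_pos (Nat.cast_pos.2 (E.N_pos m)) (Nat.cast_pos.2 (E.N_pos (m + 1)))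
  have hη0 : 0 ≤ Cη * ρ ^ ση := mul_nonneg hCη.le (Real.rpow_nonneg hρ0 _)
  set D₁ : ℝ := ‖x₁‖ ^ 2 - ‖Um 0 t x₁‖ ^ 2 with hD₁_def
  have hv₁le : ‖Um 0 t x₁‖ ≤ ‖x₁‖ := hUm.norm_le _ _ _
  have hD₁0 : 0 ≤ D₁ := by rw [hD₁_def]; exact sub_nonneg.2 (pow_le_pow_left₀ (norm_nonneg _) hv₁le 2)
  set ε₁ : ℝ := Cη * ρ ^ ση with hε₁_def
  have hε₁0 : 0 ≤ ε₁ := hη0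
  have hmain₁ : ‖Um1 0 t x₁‖ ^ 2 ≤ ‖Um 0 t x₁‖ ^ 2 + ε₁ * D₁ := hcmp₁
  -- (P4) trim: restore the tail `x₂ := x - x₁ ⊥ x₁` with `trim_compare`, `ε := min ε₁ 1`
  have horth : ⟪x₁, x - x₁⟫_ℝ = 0 := by
    rw [inner_sub_right, real_inner_self_eq_norm_sq, hx₁, real_inner_comm, inner_cutLp_self, sub_self]
  have hledger : ‖Um1 0 t x₁‖ ^ 2 ≤ ‖Um 0 t x₁‖ ^ 2 + min ε₁ 1 * D₁ := by
    rcases min_cases ε₁ 1 with ⟨h, _⟩ | ⟨h, _⟩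
    · rw [h]; exact hmain₁
    · rw [h, one_mul, hD₁_def]
      linarith only [pow_le_pow_left₀ (norm_nonneg _) (hUm1.norm_le 0 t x₁) 2]
  have htc := trim_compare (Um 0 t) (Um1 0 t) (fun y => hUm.norm_le _ _ y) (fun y => hUm1.norm_le _ _ y) x₁ (x - x₁) horth
    (le_min hε₁0 zero_le_one) (min_le_right _ _) hledger
  rw [add_sub_cancel] at htc
  -- the tail budget: `4π² ‖x₂‖² ≤ Cτ ρ^στ · D` from the export, the spectral gap and the `stub_baseT` floor
  set D : ℝ := ‖x‖ ^ 2 - ‖Um 0 t x‖ ^ 2 with hD_def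
  have hvle : ‖Um 0 t x‖ ≤ ‖x‖ := hUm.norm_le _ _ _
  have hD0 : 0 ≤ D := by rw [hD_def]; exact sub_nonneg.2 (pow_le_pow_left₀ (norm_nonneg _) hvle 2)
  set B : ℝ := 1 - Real.exp (-(4 * Real.pi ^ 2 * (E.kbar m * lo))) with hB_def
  have hBD : B * ‖x‖ ^ 2 ≤ D := by
    have := hbt; simp only [drop] at this; rw [hEv, hE0] at this; exact this
  set A : ℝ := ‖x - x₁‖ ^ 2 with hA_def
  have hgap : 4 * Real.pi ^ 2 * ((Lc : ℝ) ^ 2 + 1) * A ≤ (R : ℝ) * ‖x‖ ^ 2 := by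
    rw [hA_def, hx₁]; exact norm_sub_cutLp_sq_le_of_inClass hw₀ hR Lc
  have hcoef0 : 0 ≤ Cτ * ρ ^ στ * (Lc : ℝ) ^ 2 := by positivity
  have hA : 4 * Real.pi ^ 2 * A ≤ Cτ * ρ ^ στ * D := by
    have hL1 : 0 < (Lc : ℝ) ^ 2 + 1 := by positivity
    have h1 : ((Lc : ℝ) ^ 2 + 1) * (4 * Real.pi ^ 2 * A) ≤ ((Lc : ℝ) ^ 2 + 1) * (Cτ * ρ ^ στ * D) :=
      calc ((Lc : ℝ) ^ 2 + 1) * (4 * Real.pi ^ 2 * A) = 4 * Real.pi ^ 2 * ((Lc : ℝ) ^ 2 + 1) * A := by ring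
        _ ≤ (R : ℝ) * ‖x‖ ^ 2 := hgap
        _ ≤ Cτ * ρ ^ στ * (Lc : ℝ) ^ 2 * B * ‖x‖ ^ 2 := mul_le_mul_of_nonneg_right htrim (sq_nonneg _)
        _ = Cτ * ρ ^ στ * (Lc : ℝ) ^ 2 * (B * ‖x‖ ^ 2) := by ring
        _ ≤ Cτ * ρ ^ στ * (Lc : ℝ) ^ 2 * D := mul_le_mul_of_nonneg_left hBD hcoef0
        _ ≤ Cτ * ρ ^ στ * ((Lc : ℝ) ^ 2 + 1) * D :=
          mul_le_mul_of_nonneg_right (mul_le_mul_of_nonneg_left (by linarith) (by positivity)) hD0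
        _ = ((Lc : ℝ) ^ 2 + 1) * (Cτ * ρ ^ στ * D) := by ring
    exact le_of_mul_le_mul_left h1 hL1
  -- AM–GM with weight `δ := ρ^{στ/2}`: `6‖x₂‖√D ≤ 3(A/δ + δD)`, and `A ≤ Cτ' δ² D`
  set Cτ' : ℝ := Cτ / (4 * Real.pi ^ 2) with hCτ'_def
  have hCτ'0 : 0 ≤ Cτ' := by positivity
  set δ : ℝ := ρ ^ (στ / 2) with hδ_def
  have hδ : 0 < δ := Real.rpow_pos_of_pos hρpos _
  have hδ1 : δ ≤ 1 := Real.rpow_le_one hρ0 hρ1 (half_pos hστ).le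
  have hδδ : ρ ^ στ = δ * δ := by rw [hδ_def, ← Real.rpow_add hρpos, add_halves]
  have hA' : A ≤ Cτ' * (δ * δ) * D := by
    rw [hCτ'_def, ← hδδ]
    have hπ : 0 < 4 * Real.pi ^ 2 := by positivity
    rw [div_mul_eq_mul_div, div_mul_eq_mul_div, le_div_iff₀ hπ]
    linarith only [hA]
  have hsq : Real.sqrt D ^ 2 = D := Real.sq_sqrt hD0
  have hamgm : 6 * ‖x - x₁‖ * Real.sqrt D * δ ≤ 3 * A + 3 * (δ * δ) * D := by
    have hid : 3 * ‖x - x₁‖ ^ 2 + 3 * (δ * δ) * Real.sqrt D ^ 2 - 6 * ‖x - x₁‖ * Real.sqrt D * δ =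
        3 * (‖x - x₁‖ - δ * Real.sqrt D) ^ 2 := by ring
    rw [hsq] at hid
    have h0 : 0 ≤ 3 * (‖x - x₁‖ - δ * Real.sqrt D) ^ 2 := by positivity
    rw [hA_def]; linarith only [hid, h0]
  -- `6‖x₂‖√D ≤ 3 Cτ' δ D + 3 δ D` (divide the AM–GM by δ > 0 after inserting `A ≤ Cτ' δ² D`)
  have hcross : 6 * ‖x - x₁‖ * Real.sqrt D ≤ (3 * Cτ' + 3) * δ * D := by
    have h1 : 6 * ‖x - x₁‖ * Real.sqrt D * δ ≤ ((3 * Cτ' + 3) * δ * D) * δ := by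
      have : 3 * A ≤ 3 * (Cτ' * (δ * δ) * D) := by linarith [hA']
      have hre : ((3 * Cτ' + 3) * δ * D) * δ = 3 * (Cτ' * (δ * δ) * D) + 3 * (δ * δ) * D := by ring
      rw [hre]; linarith only [hamgm, this]
    exact le_of_mul_le_mul_right h1 hδ
  have htail15 : 15 * ‖x - x₁‖ ^ 2 ≤ 15 * Cτ' * δ * D := by
    have : A ≤ Cτ' * δ * D := by
      calc A ≤ Cτ' * (δ * δ) * D := hA'
        _ ≤ Cτ' * (δ * 1) * D := by
          exact mul_le_mul_of_nonneg_right (mul_le_mul_of_nonneg_left (mul_le_mul_of_nonneg_left hδ1 hδ.le) hCτ'0) hD0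
        _ = Cτ' * δ * D := by ring
    rw [← hA_def]; linarith only [this]
  -- exponents: every rate is at least `σ₁ := min ση (στ/2)`
  have hρpow : ∀ {s : ℝ}, min ση (στ / 2) ≤ s → ρ ^ s ≤ ρ ^ min ση (στ / 2) := fun hs =>
    Real.rpow_le_rpow_of_exponent_ge' hρ0 hρ1 (lt_min hση (half_pos hστ)).le hs
  have h1 := mul_le_mul_of_nonneg_left (hρpow (min_le_left _ _)) hCη.le
  have h3 : δ ≤ ρ ^ min ση (στ / 2) := hρpow (min_le_right _ _)
  have hminε : min ε₁ 1 ≤ ε₁ := min_le_left _ _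
  have hX : 2 * ε₁ + ((3 * Cτ' + 3) * δ + 15 * Cτ' * δ) ≤
      (2 * Cη + (18 * (Cτ / (4 * Real.pi ^ 2)) + 3)) * ρ ^ min ση (στ / 2) := by
    rw [hε₁_def, ← hCτ'_def]
    have h4 := mul_le_mul_of_nonneg_left h3 (show (0:ℝ) ≤ 18 * Cτ' + 3 by positivity)
    linarith only [h1, h4]
  have hmain : ‖Um1 0 t x‖ ^ 2 ≤ ‖Um 0 t x‖ ^ 2 + (2 * ε₁ + ((3 * Cτ' + 3) * δ + 15 * Cτ' * δ)) * D := by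
    have h2ε : 2 * min ε₁ 1 * D ≤ 2 * ε₁ * D :=
      mul_le_mul_of_nonneg_right (mul_le_mul_of_nonneg_left hminε zero_le_two) hD0
    linarith only [htc, h2ε, hcross, htail15, hA_def]
  have hXD := mul_le_mul_of_nonneg_right hX hD0
  simp only [drop]
  rw [hEu, hEv, hE0, ← hD_def]
  linarith only [hmain, hXD, hD_def]

end Summit.AnomalousDissipation.AnomalousDissipation.Theorems.SolenoidalFractalHomogenisation.LagrangianStep

end
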